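import Summits.Ventures.PercRepro.C025ProfileGirthHallSuccC

/-!
# THE HALL FORM OF THE ROW `(q, q+1)` AT GIRTH `≥ q + 1` — PART D: THE THEOREM (night-3 g18)

The explicit weights of parts B–C are instantiated (as lambdas inside the proof — no `def`), their characterizing
hypotheses discharged, and `hallIneq_of_cert` gives the Hall form for `ρ(E) ≥ q + 2`; `ρ(E) < q + 1` has every price `0`.
The case `ρ(E) = q + 1` is NOT covered (the certificate needs two points outside the closure of every rank-`q` set; the
row itself is complementation there, `profileIneq_of_eRank_eq`).
* `hallIneq_of_eRank_lt` — the Hall form at `ρ(E) < u`;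
* **`hallIneq_succ_of_girth_rank`** `(hq : 2 ≤ q) (hg : ∀ T ⊆ M.E, T.encard ≤ q → M.Indep T) (hrank : q + 2 ≤ ρ(E)) :
  Profile.HallIneq M q (q + 1)` — C-033 at `(q, q+1)` on every finite matroid of rank `≥ q + 2` in which every set of at
  most `q` points is independent, `q ≥ 2`;
* `hallIneq_succ_of_girth_of_ne` — the same for every rank `≠ q + 1`.
No `def`, no `instance`, no notation.  Axioms: standard.
-/

open scoped Matroid

namespace PercRepro

open Set Finset ThmH Staged

namespace GirthRows

variable {α : Type} [DecidableEq α] {M : Matroid α} [M.Finite]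

open scoped Classical

/-- The Hall form at a level above the rank: every price is `0`. -/
theorem hallIneq_of_eRank_lt {q u : ℕ} (h : M.eRank < u) : Profile.HallIneq M q u := by
  intro 𝒜 _
  rw [Finset.sum_eq_zero (fun B _ => price_eq_zero_of_eRank_lt h B)]
  exact Nat.cast_nonneg _

/-- **THE HALL FORM `(H⁺_{q,q+1})` AT GIRTH `≥ q + 1` ON MATROIDS OF RANK `≥ q + 2`** (`q ≥ 2`): for every family `𝒜` of
rank-`q` sets, `Σ_{B ∈ 𝒜} price(B) ≤ #{S : ρ(S) = q + 1, S ⊇ some B ∈ 𝒜}` — by the per-pair certificate of parts B–C. -/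
theorem hallIneq_succ_of_girth_rank {q : ℕ} (hq : 2 ≤ q) (hg : ∀ T ⊆ M.E, T.encard ≤ q → M.Indep T)
    (hrank : ((q + 2 : ℕ) : ℕ∞) ≤ M.eRank) : Profile.HallIneq M q (q + 1) := by
  -- the weights
  set t : Finset α → ℚ := fun B => 1 / (2 * ((q : ℚ) + 1) *
    ((((gr M).filter (fun x => x ∈ M.closure (B : Set α))).card - q - 1 : ℕ) : ℚ)) with ht_def
  set wgt : Finset α → ℚ := fun B =>
    if B.card = q + 1 then 1 - 1 / (((gr M).filter (fun x => x ∉ M.closure (B : Set α))).card : ℚ)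
    else if B.card = q + 2 ∧ ((gr M).filter (fun x => x ∉ M.closure (B : Set α))).card = 2 ∧
        2 * q + 1 ≤ ((gr M).filter (fun x => x ∈ M.closure (B : Set α))).card then 1 - ((q : ℚ) + 2) * t B
    else 1 with hwgt_def
  set W : Finset α → Finset α → ℚ := fun B S =>
    if B ⊆ S ∧ B.card = q ∧ S.card = q + 1 then 1 / ((q : ℚ) + 1)
    else if B ⊆ S ∧ B.card = q ∧ S.card = q + 2 ∧ ((S \ B).filter (fun x => x ∈ M.closure (B : Set α))).card = 1 then
      1 / (((q : ℚ) + 1) * (((gr M).filter (fun x => x ∉ M.closure (B : Set α))).card : ℚ))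
    else if B ⊆ S ∧ q + 1 ≤ B.card ∧ S.card = B.card + 1 ∧
        ((S \ B).filter (fun x => x ∈ M.closure (B : Set α))).card = 0 then wgt B
    else if B ⊆ S ∧ B.card = q + 1 ∧ ((gr M).filter (fun x => x ∉ M.closure (B : Set α))).card = 2 ∧
        2 * q + 1 ≤ ((gr M).filter (fun x => x ∈ M.closure (B : Set α))).card ∧ S.card = q + 3 ∧
        ((S \ B).filter (fun x => x ∈ M.closure (B : Set α))).card = 1 then t B
    else 0 with hW_def
  -- the facts about t and wgt
  have ht : ∀ B : Finset α, t B = 1 / (2 * ((q : ℚ) + 1) *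
      ((((gr M).filter (fun x => x ∈ M.closure (B : Set α))).card - q - 1 : ℕ) : ℚ)) := fun B => rfl
  have htnn : ∀ B, 0 ≤ t B := by
    intro B; rw [ht B]; positivity
  have hw1 : ∀ B : Finset α, B.card = q + 1 →
      wgt B = 1 - 1 / (((gr M).filter (fun x => x ∉ M.closure (B : Set α))).card : ℚ) := by
    intro B hB
    rw [hwgt_def]; dsimp only
    rw [if_pos hB]
  have hw2 : ∀ B : Finset α, B.card = q + 2 → ((gr M).filter (fun x => x ∉ M.closure (B : Set α))).card = 2 →
      2 * q + 1 ≤ ((gr M).filter (fun x => x ∈ M.closure (B : Set α))).card → wgt B = 1 - ((q : ℚ) + 2) * t B := by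
    intro B hB hm hN
    rw [hwgt_def]; dsimp only
    rw [if_neg (by omega), if_pos ⟨hB, hm, hN⟩]
  have hw3 : ∀ B : Finset α, B.card = q + 2 → ¬ (((gr M).filter (fun x => x ∉ M.closure (B : Set α))).card = 2 ∧
      2 * q + 1 ≤ ((gr M).filter (fun x => x ∈ M.closure (B : Set α))).card) → wgt B = 1 := by
    intro B hB hc
    rw [hwgt_def]; dsimp only
    rw [if_neg (by omega), if_neg (fun h => hc h.2)]
  have hw5 : ∀ B : Finset α, q + 3 ≤ B.card → wgt B = 1 := by
    intro B hB
    rw [hwgt_def]; dsimp only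
    rw [if_neg (by omega), if_neg (fun h => by omega)]
  have hw4 : ∀ B : Finset α, wgt B ≤ 1 := by
    intro B
    rw [hwgt_def]; dsimp only
    split_ifs with h1 h2
    · have : (0 : ℚ) ≤ 1 / (((gr M).filter (fun x => x ∉ M.closure (B : Set α))).card : ℚ) := by positivity
      linarith
    · have := htnn B
      have hq' : (0 : ℚ) ≤ (q : ℚ) + 2 := by positivity
      nlinarith
    · exact le_refl 1
  have hwnn : ∀ B : Finset α, 0 ≤ wgt B := by
    intro B
    rw [hwgt_def]; dsimp only
    split_ifs with h1 h2
    · have hm : 2 ≤ ((gr M).filter (fun x => x ∉ M.closure (B : Set α))).card ∨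
          ((gr M).filter (fun x => x ∉ M.closure (B : Set α))).card < 2 := by omega
      rcases hm with hm | hm
      · have : (2 : ℚ) ≤ (((gr M).filter (fun x => x ∉ M.closure (B : Set α))).card : ℚ) := by exact_mod_cast hm
        have : 1 / (((gr M).filter (fun x => x ∉ M.closure (B : Set α))).card : ℚ) ≤ 1 / 2 := by
          apply div_le_div_of_nonneg_left (by norm_num) (by norm_num) this
        linarith
      · -- fewer than two points outside: only happens for non-rank-q sets; bound crudely via the cast
        rcases Nat.lt_or_ge ((gr M).filter (fun x => x ∉ M.closure (B : Set α))).card 1 with h0 | h1'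
        · have : ((gr M).filter (fun x => x ∉ M.closure (B : Set α))).card = 0 := by omega
          rw [this]; norm_num
        · have : ((gr M).filter (fun x => x ∉ M.closure (B : Set α))).card = 1 := by omega
          rw [this]; norm_num
    · rw [ht B]
      have hN : (q : ℚ) + 2 ≤ ((((gr M).filter (fun x => x ∈ M.closure (B : Set α))).card - q - 1 : ℕ) : ℚ) * q := by
        have h3 : q ≤ ((gr M).filter (fun x => x ∈ M.closure (B : Set α))).card - q - 1 := by omega
        have : q + 2 ≤ (((gr M).filter (fun x => x ∈ M.closure (B : Set α))).card - q - 1) * q := by nlinarith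
        exact_mod_cast this
      have hDpos : (0 : ℚ) < ((((gr M).filter (fun x => x ∈ M.closure (B : Set α))).card - q - 1 : ℕ) : ℚ) := by
        exact_mod_cast (by omega : 0 < ((gr M).filter (fun x => x ∈ M.closure (B : Set α))).card - q - 1)
      set D : ℚ := ((((gr M).filter (fun x => x ∈ M.closure (B : Set α))).card - q - 1 : ℕ) : ℚ) with hD
      have hq' : (0 : ℚ) < (q : ℚ) + 1 := by positivity
      have : ((q : ℚ) + 2) * (1 / (2 * ((q : ℚ) + 1) * D)) ≤ 1 := by
        rw [mul_one_div, div_le_one (by positivity)]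
        nlinarith
      linarith
    · exact zero_le_one
  -- the facts about W
  have hnn : ∀ B S, 0 ≤ W B S := by
    intro B S
    rw [hW_def]; dsimp only
    split_ifs
    · positivity
    · positivity
    · exact hwnn B
    · exact htnn B
    · exact le_refl 0
  have h1 : ∀ B S : Finset α, B ⊆ S → B.card = q → S.card = q + 1 → W B S = 1 / ((q : ℚ) + 1) := by
    intro B S hBS hB hS
    rw [hW_def]; dsimp only
    rw [if_pos ⟨hBS, hB, hS⟩]
  have h2 : ∀ B S : Finset α, B ⊆ S → B.card = q → S.card = q + 2 →
      ((S \ B).filter (fun x => x ∈ M.closure (B : Set α))).card = 1 →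
      W B S = 1 / (((q : ℚ) + 1) * (((gr M).filter (fun x => x ∉ M.closure (B : Set α))).card : ℚ)) := by
    intro B S hBS hB hS hc
    rw [hW_def]; dsimp only
    rw [if_neg (fun h => by omega), if_pos ⟨hBS, hB, hS, hc⟩]
  have h3 : ∀ B S : Finset α, B ⊆ S → q + 1 ≤ B.card → S.card = B.card + 1 →
      ((S \ B).filter (fun x => x ∈ M.closure (B : Set α))).card = 0 → W B S = wgt B := by
    intro B S hBS hB hS hc
    rw [hW_def]; dsimp only
    rw [if_neg (fun h => by omega), if_neg (fun h => by omega), if_pos ⟨hBS, hB, hS, hc⟩]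
  have h4 : ∀ B S : Finset α, B ⊆ S → B.card = q + 1 →
      ((gr M).filter (fun x => x ∉ M.closure (B : Set α))).card = 2 →
      2 * q + 1 ≤ ((gr M).filter (fun x => x ∈ M.closure (B : Set α))).card → S.card = q + 3 →
      ((S \ B).filter (fun x => x ∈ M.closure (B : Set α))).card = 1 → W B S = t B := by
    intro B S hBS hB hm hN hS hc
    rw [hW_def]; dsimp only
    rw [if_neg (fun h => by omega), if_neg (fun h => by omega), if_neg (fun h => by omega),
      if_pos ⟨hBS, hB, hm, hN, hS, hc⟩]
  have h0 : ∀ B S : Finset α,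
      ¬ (B ⊆ S ∧ B.card = q ∧ S.card = q + 1) →
      ¬ (B ⊆ S ∧ B.card = q ∧ S.card = q + 2 ∧ ((S \ B).filter (fun x => x ∈ M.closure (B : Set α))).card = 1) →
      ¬ (B ⊆ S ∧ q + 1 ≤ B.card ∧ S.card = B.card + 1 ∧
          ((S \ B).filter (fun x => x ∈ M.closure (B : Set α))).card = 0) →
      ¬ (B ⊆ S ∧ B.card = q + 1 ∧ ((gr M).filter (fun x => x ∉ M.closure (B : Set α))).card = 2 ∧
          2 * q + 1 ≤ ((gr M).filter (fun x => x ∈ M.closure (B : Set α))).card ∧ S.card = q + 3 ∧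
          ((S \ B).filter (fun x => x ∈ M.closure (B : Set α))).card = 1) → W B S = 0 := by
    intro B S c1 c2 c3 c4
    rw [hW_def]; dsimp only
    rw [if_neg c1, if_neg c2, if_neg c3, if_neg c4]
  exact hallIneq_of_cert q (q + 1) W hnn (cap_of_weights hg hrank W wgt t hw1 hw2 hw3 hw4 ht h1 h2 h3 h4 h0)
    (dem_of_weights hq hrank W wgt t hnn hw1 hw2 hw3 hw5 ht h1 h2 h3 h4)

/-- The Hall form `(H⁺_{q,q+1})` at girth `≥ q + 1` for every rank other than `q + 1`. -/
theorem hallIneq_succ_of_girth_of_ne {q : ℕ} (hq : 2 ≤ q) (hg : ∀ T ⊆ M.E, T.encard ≤ q → M.Indep T)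
    (hne : M.eRank ≠ ((q + 1 : ℕ) : ℕ∞)) : Profile.HallIneq M q (q + 1) := by
  rcases lt_or_ge M.eRank ((q + 2 : ℕ) : ℕ∞) with hlt | hge
  · apply hallIneq_of_eRank_lt
    have hfin : M.eRank ≠ ⊤ := ne_top_of_lt hlt
    rw [← ENat.coe_toNat hfin] at hlt hne ⊢
    have b : M.eRank.toNat < q + 2 := by exact_mod_cast hlt
    have c : M.eRank.toNat ≠ q + 1 := by
      intro h; apply hne; rw [h]
    exact_mod_cast (by omega : M.eRank.toNat < q + 1)
  · exact hallIneq_succ_of_girth_rank hq hg hge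

end GirthRows

end PercRepro
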